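import Summits.HodgeConjecture.CorCM.MultiFieldWeilUnitsRealised
import HarnessLib

/-!
# MULTI-FIELD WEIL ENGINE — THE DEFECT LAW WITH SEPARATED UNITS: the per-unit separation supplied ABSTRACTLY (every solution of the unit's signed equations over the realised
# tuples is constant), so that units whose image is NOT `2`-transitive — dihedral decic fields — enter the menu (census, realised, frame headline)

Cell `pub-hodgecm2` (COR-CM), seat b30 gen 42 (2026-08-26); count-neutral own lane MULTI-FIELD WEIL ENGINE (stem `MultiFieldWeil*`), the variant of U2
`CorCM/MultiFieldWeilUnitsDefectLaw.lean` (`exists_hasDefectsG_of_unitsStabiliserTransitive`) and of its realised reading ∕ frame headline `CorCM/MultiFieldWeilUnitsRealised.lean`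
in which the hypotheses «`2`-transitive on every unit with at least two slots» (`h2t`) and «centred indicators linearly independent over `ℚ`» (`hli`) — U1's separation over a
`2`-transitive image — are replaced by the ABSTRACT SEPARATION PROPERTY of the unit:

  `hunit m`: for every family `u` of integer defects on the unit of `m` (read in the size `n m` through the casts) and every `w`, if the unit's total signed sum
  `Σ_{m' ∈ unit} Σ_x ±_{π_m x ∈ P_{m'}} u_{m'}(x)` equals `w` for every realised tuple `π ∈ R`, then every `u_{m'}` is constant.

U1 (`const_of_signed_unit_of_linearIndependent`) says that `h2t` + `hli` imply `hunit`; the DIHEDRAL PENTAGON (`CorCM/MultiFieldWeilDihedralFive{,Criterion}.lean`: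
`const_of_signed_dihedral_five_conj`) supplies `hunit` for a decic unit whose image is the dihedral group `D₅` (NOT `2`-transitive) and whose position sets are independent over
`ℚ(√5)`; the proof of the defect law is U2's VERBATIM except that the unit of `m` is separated by `hunit` (the hybrids `(π|_unit, 1)` of the realised tuples put every `π_m`,
`π ∈ R`, into the set on which the unit's signed sum is constant).  Theorems only; no definition, no named fact, no `sorry`.  HONEST FRAMING: the conclusion of the headline is the
Hodge conjecture for products of copies GIVEN the single-slot Weil spaces `hW`; `HC_CM` is NOT asserted.

* §1 `exists_hasDefectsG_of_unitsSeparated` (census) · §2 `exists_hasDefectsG_realisedTuples_of_unitsSeparated` (realised) · §3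
  `hodgeConjectureFor_biproduct_comp_of_unitsSeparated_frames` (+ dominated form) — the frame headline consumed by the dihedral-decic menu of the sequel.
[cite: MoonenZarhin1995Duke, Thm. 2.4] [cite: Pohlmann1968, Thm 1] [cite: GaoUllmo2025, Thm 3.1] [cite: Shimura1998, §18.2 Lemma (i)] [cite: DixonMortimer1996, §1.4 Ex. 1.4.1–1.4.2;
§1.6, Thm. 1.6A; §2.1] [cite: Lang2002, XIII §4] [cite: Milne2020HodgeClassesAV, 1.2 (a) and Thm. 1] [cite: MumfordAV1970, §19 Thm. 1 and p. 169]

## References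
* [MoonenZarhin1995Duke] B. Moonen, Yu. Zarhin, Duke Math. J. 77 (1995), Thm. 2.4.  [Pohlmann1968] H. Pohlmann, Ann. of Math. 88 (1968), Thm 1.  [GaoUllmo2025] Z. Gao, E. Ullmo,
  J. Inst. Math. Jussieu 25 (2025), Thm 3.1.  [Shimura1998] G. Shimura, *Abelian varieties with complex multiplication and modular functions*, §18.2 Lemma (i).
  [DixonMortimer1996] J. D. Dixon, B. Mortimer, *Permutation Groups*, GTM 163, §1.4, §1.6 (Thm. 1.6A), §2.1.  [Lang2002] S. Lang, *Algebra*, GTM 211, XIII §4.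
  [Milne2020HodgeClassesAV] J. S. Milne, arXiv:2010.08857, 1.2 (a), Thm. 1.  [MumfordAV1970] D. Mumford, *Abelian Varieties*, §19.
-/

noncomputable section

open CategoryTheory CategoryTheory.Limits NumberField IntermediateField

namespace Summit.HodgeConjecture.CorCM.MultiFieldWeil

open Finset
open Literature.AlgebraicGeometry Literature.AlgebraicGeometry.Motives Literature.AlgebraicGeometry.HodgeTheory
open Literature.AlgebraicGeometry.ComplexMultiplication (IsCMTypeRealisation)
open Literature.AlgebraicTopology.SingularHomology
open Literature.NumberTheory.ComplexMultiplication
open Summit.HodgeConjecture.CorCM.Census.MultiFieldWeil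

open scoped Classical

/-! ## §1 The defect law with separated units (census) -/

section Model

variable {r : ℕ} {n : Fin r → ℕ} {R : Finset (PermsG n)} {P : ∀ m : Fin r, Finset (Fin (n m))}

/-- **THE DEFECT LAW WITH SEPARATED UNITS AND THE SLOT MENU ON THE SINGLE SLOTS** (census).  U2 with `h2t` + `hli` replaced by the abstract per-unit separation `hunit`; see the
module docstring. [cite: MoonenZarhin1995Duke, Thm. 2.4] [cite: DixonMortimer1996, §1.4 Ex. 1.4.1–1.4.2; §1.6, Thm. 1.6A; §2.1] [cite: GaoUllmo2025, Thm 3.1] [cite: Lang2002, XIII §4] -/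
theorem exists_hasDefectsG_of_unitsSeparated (hmul : ∀ π ∈ R, ∀ π' ∈ R, π * π' ∈ R) (hinv : ∀ π ∈ R, π⁻¹ ∈ R) (hne : R.Nonempty)
    (htrans : ∀ (m : Fin r) (a a' : Fin (n m)), ∃ π ∈ R, π m a = a')
    (U : Fin r → Fin r) (hn : ∀ m m' : Fin r, U m' = U m → n m' = n m)
    (hdiag : ∀ π ∈ R, ∀ (m m' : Fin r) (h : U m' = U m) (a : Fin (n m')), Fin.cast (hn m m' h) (π m' a) = π m (Fin.cast (hn m m' h) a))
    (hstab : ∀ (m₀ m : Fin r), U m₀ ≠ U m → ∀ a a' : Fin (n m), ∃ ν ∈ R, (∀ m', U m' = U m₀ → ν m' = 1) ∧ ν m a = a')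
    (hkind : ∀ m, (∀ m', U m' = U m → m' = m) → ((n m).Prime ∧ (P m).Nonempty ∧ (P m).card < n m) ∨ (P m).card = 1 ∨
      ((0 < (P m).card ∧ (P m).card < n m) ∧ ∀ Q : Finset (Fin (n m)), Q.card = (P m).card → ∃ π ∈ R, preG (π m) (P m) = Q))
    (hunit : ∀ m, (∃ m', m' ≠ m ∧ U m' = U m) → ∀ (u : {m' : Fin r // U m' = U m} → Fin (n m) → ℤ) (w : ℤ),
      (∀ π ∈ R, (∑ i, ∑ x : Fin (n m), (if π m x ∈ (P i.1).image (Fin.cast (hn m i.1 i.2)) then u i x else -u i x)) = w) →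
      ∀ (i : {m' : Fin r // U m' = U m}) (a b : Fin (n m)), u i a = u i b)
    (c : Fin r → ℕ) (hc : ∀ m, ((c m : ℕ) : ℤ) = (n m : ℤ) - 2 * (P m).card)
    {α : Type} (v : α → PtG n) (T : Finset α) (hT : ModelBalancedG P R v T) : ∃ t : Fin r → ℤ, HasDefectsG c v T t := by
  have h1R : (1 : PermsG n) ∈ R := one_mem_of_closed hmul hinv hne
  -- the unit-wise product `R'`
  set R' : Finset (PermsG n) := Finset.univ.filter fun π' => ∀ m₀, ∃ π ∈ R, ∀ m, U m = U m₀ → π m = π' m with hR'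
  have hmemR' : ∀ π' : PermsG n, π' ∈ R' ↔ ∀ m₀, ∃ π ∈ R, ∀ m, U m = U m₀ → π m = π' m := fun π' => by simp [hR']
  have hRR' : R ⊆ R' := fun π hπ => (hmemR' π).2 fun m₀ => ⟨π, hπ, fun _ _ => rfl⟩
  have hne' : R'.Nonempty := hne.mono hRR'
  have h1R' : (1 : PermsG n) ∈ R' := hRR' h1R
  -- hybrids: a tuple of `R` on the unit of `m`, the identity elsewhere, lies in `R'`
  have hhyb : ∀ (m : Fin r) (π : PermsG n), π ∈ R → (fun m' => if U m' = U m then π m' else 1) ∈ R' := by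
    intro m π hπ
    rw [hmemR']
    intro m₀
    by_cases hm₀ : U m₀ = U m
    · refine ⟨π, hπ, fun m' hm' => ?_⟩
      simp only [hm'.trans hm₀, if_true]
    · refine ⟨1, h1R, fun m' hm' => ?_⟩
      have : U m' ≠ U m := fun h => hm₀ (hm'.symm.trans h)
      simp only [this, if_false, Pi.one_apply]
  -- diagonality inside `R'`
  have hdiag' : ∀ π ∈ R', ∀ (m m' : Fin r) (h : U m' = U m) (a : Fin (n m')), Fin.cast (hn m m' h) (π m' a) = π m (Fin.cast (hn m m' h) a) := by
    intro π hπ m m' h a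
    obtain ⟨ρ, hρ, hρe⟩ := (hmemR' π).1 hπ m
    rw [← hρe m rfl, ← hρe m' h]
    exact hdiag ρ hρ m m' h a
  -- the defects and the signed equations at `R`, transferred to `R'`
  set d : ∀ m : Fin r, Fin (n m) → ℤ := fun m a => ((cnt v T (Sum.inr ⟨m, (a, true)⟩)) : ℤ) - cnt v T (Sum.inr ⟨m, (a, false)⟩) with hd
  have hsig : ∀ π ∈ R', (((cnt v T (Sum.inl true)) : ℤ) - cnt v T (Sum.inl false)) +
      ∑ m : Fin r, ∑ a : Fin (n m), (if π m a ∈ P m then d m a else -d m a) = 0 := fun π' hπ' =>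
    signed_transfer_units (d := d) U hmul hne htrans hstab (fun π hπ => signed_of_modelBalancedG R v hT hπ) π' ((hmemR' π').1 hπ')
  -- every SINGLE slot is moved ALONE inside `R'`: its defect is constant by slot-wise separation (Z1)
  have hupd : ∀ m₀, (∀ m', U m' = U m₀ → m' = m₀) → ∀ π₁ ∈ R, Function.update (1 : PermsG n) m₀ (π₁ m₀) ∈ R' := by
    intro m₀ hsingle π₁ hπ₁
    refine (hmemR' _).2 fun m' => ?_
    by_cases hm' : U m' = U m₀
    · refine ⟨π₁, hπ₁, fun m hmm => ?_⟩
      have hmm' : m = m₀ := hsingle m (hmm.trans hm')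
      subst hmm'
      rw [Function.update_self]
    · refine ⟨1, h1R, fun m hmm => ?_⟩
      have hmm' : m ≠ m₀ := fun h => hm' (by rw [← h, hmm])
      rw [Function.update_of_ne hmm', Pi.one_apply]
  have hconst : ∀ m₀, (∀ m', U m' = U m₀ → m' = m₀) → ∀ a b : Fin (n m₀), d m₀ a = d m₀ b := fun m₀ hsingle =>
    sep_of_kind hmul hinv hne (htrans m₀) (hkind m₀ hsingle) (d m₀) fun π hπ => sum_preG_eq_of_signed_update (d := d) h1R' (hupd m₀ hsingle π hπ) hsig
  -- every LARGER unit is moved ALONE inside `R'` by the hybrids `(π|_unit, 1)`: U1's unit separation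
  have hunits : ∀ m, (∃ m', m' ≠ m ∧ U m' = U m) → ∀ a b : Fin (n m), d m a = d m b := by
    intro m hm
    -- the tuples of `R'` trivial off the unit of `m`
    let D : Finset (PermsG n) := R'.filter fun π => ∀ m', U m' ≠ U m → π m' = 1
    have hD : ∀ π, π ∈ D ↔ π ∈ R' ∧ ∀ m', U m' ≠ U m → π m' = 1 := fun π => Finset.mem_filter
    have hhybD : ∀ π ∈ R, (fun m' => if U m' = U m then π m' else 1) ∈ D := fun π hπ =>
      (hD _).2 ⟨hhyb m π hπ, fun m' hm' => by simp only [hm', if_false]⟩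
    -- its image at the slot `m`: closed under products, `2`-transitive
    let Hm : Finset (Equiv.Perm (Fin (n m))) := D.image fun π => π m
    have hHm : ∀ σ, σ ∈ Hm ↔ ∃ π ∈ D, π m = σ := fun σ => Finset.mem_image
    -- the unit's signed sum is constant on `D`
    set w : ℤ := -((((cnt v T (Sum.inl true)) : ℤ) - cnt v T (Sum.inl false)) +
      ∑ m' ∈ Finset.univ.filter (fun m' => ¬ U m' = U m), ∑ a : Fin (n m'), (if (1 : PermsG n) m' a ∈ P m' then d m' a else -d m' a)) with hw
    have heqD : ∀ π ∈ D, (∑ m' ∈ Finset.univ.filter (fun m' => U m' = U m), ∑ a : Fin (n m'), (if π m' a ∈ P m' then d m' a else -d m' a)) = w := by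
      intro π hπ
      obtain ⟨hπR', hπfix⟩ := (hD π).1 hπ
      have hs := hsig π hπR'
      rw [← Finset.sum_filter_add_sum_filter_not Finset.univ (fun m' => U m' = U m)] at hs
      have hrest : (∑ m' ∈ Finset.univ.filter (fun m' => ¬ U m' = U m), ∑ a : Fin (n m'), (if π m' a ∈ P m' then d m' a else -d m' a)) =
          ∑ m' ∈ Finset.univ.filter (fun m' => ¬ U m' = U m), ∑ a : Fin (n m'), (if (1 : PermsG n) m' a ∈ P m' then d m' a else -d m' a) :=
        Finset.sum_congr rfl fun m' hm' => by rw [hπfix m' (Finset.mem_filter.1 hm').2, Pi.one_apply]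
      rw [hrest] at hs
      simp only [hw]
      linarith
    -- read the unit in the size `n m` through the casts
    let ι : Type := {m' : Fin r // U m' = U m}
    let Q : ι → Finset (Fin (n m)) := fun i => (P i.1).image (Fin.cast (hn m i.1 i.2))
    let u : ι → Fin (n m) → ℤ := fun i x => d i.1 (Fin.cast (hn m i.1 i.2).symm x)
    have hcc : ∀ (i : ι) (a : Fin (n i.1)), Fin.cast (hn m i.1 i.2).symm (Fin.cast (hn m i.1 i.2) a) = a := fun i a => Fin.ext rfl
    have hslot : ∀ π ∈ D, ∀ i : ι, (∑ x : Fin (n m), (if π m x ∈ Q i then u i x else -u i x)) =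
        ∑ a : Fin (n i.1), (if π i.1 a ∈ P i.1 then d i.1 a else -d i.1 a) := by
      intro π hπ i
      symm
      refine Fintype.sum_equiv (finCongr (hn m i.1 i.2)) _ _ fun a => ?_
      have hπa : π m (Fin.cast (hn m i.1 i.2) a) = Fin.cast (hn m i.1 i.2) (π i.1 a) := (hdiag' π ((hD π).1 hπ).1 m i.1 i.2 a).symm
      simp only [finCongr_apply, Q, u, hπa, (Fin.cast_injective _).mem_finset_image, hcc]
    have heqH : ∀ σ ∈ Hm, (∑ i : ι, ∑ x : Fin (n m), (if σ x ∈ Q i then u i x else -u i x)) = w := by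
      intro σ hσ
      obtain ⟨π, hπ, rfl⟩ := (hHm σ).1 hσ
      rw [Finset.sum_congr rfl fun i _ => hslot π hπ i, ← heqD π hπ]
      exact (Finset.sum_subtype (Finset.univ.filter fun m' => U m' = U m) (fun m' => by simp only [Finset.mem_filter, Finset.mem_univ, true_and])
        (fun m' => ∑ a : Fin (n m'), (if π m' a ∈ P m' then d m' a else -d m' a))).symm
    -- the realised tuples of `R` act on the slot `m` through their hybrids: the unit's separation property applies
    have hsep := hunit m hm u w (fun π hπ => heqH (π m)
      ((hHm _).2 ⟨_, hhybD π hπ, by show (if U m = U m then π m else 1) = π m; rw [if_pos rfl]⟩)) ⟨m, rfl⟩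
    intro a b
    have ha : d m a = u ⟨m, rfl⟩ (Fin.cast (hn m m rfl) a) := by simp only [u, hcc ⟨m, rfl⟩]
    have hb : d m b = u ⟨m, rfl⟩ (Fin.cast (hn m m rfl) b) := by simp only [u, hcc ⟨m, rfl⟩]
    rw [ha, hb]
    exact hsep _ _
  -- all defects are constant
  have hall : ∀ (m : Fin r) (a b : Fin (n m)), d m a = d m b := by
    intro m
    by_cases hm : ∃ m', m' ≠ m ∧ U m' = U m
    · exact hunits m hm
    · push Not at hm
      exact hconst m fun m' hm' => by by_contra h; exact hm m' h hm'
  obtain ⟨t, hdt, he⟩ := exists_defects_of_const (P := P) hne' hall hsig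
  refine ⟨t, fun m a => hdt m a, ?_⟩
  rw [he]
  exact Finset.sum_congr rfl fun m _ => by rw [hc m]

end Model

/-! ## §2 The realised reading -/

section Realised

variable {I : Type} {r : ℕ} {Kf : I → Type} [∀ i, Field (Kf i)] [∀ i, NumberField (Kf i)] {i₀ : I} {is : Fin r → I} {n : Fin r → ℕ}
  {e : ∀ m : Fin r, (Kf (is m) →+* ℂ) ≃ Fin (n m) × Bool} {τ : Kf i₀ →+* ℂ} {im : ∀ m : Fin r, Kf i₀ →+* Kf (is m)}
  (he_sign : ∀ (m : Fin r) (s : Kf (is m) →+* ℂ), (e m s).2 = true ↔ s.comp (im m) = τ)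

include he_sign in
/-- **THE DEFECT LAW FOR REALISED TUPLES WITH SEPARATED UNITS** (`exists_hasDefectsG_of_unitsSeparated` for the realised tuples: units = the fibres of `U`, one size and diagonal
realised tuples inside a unit; on every unit with at least two slots the ABSTRACT SEPARATION PROPERTY — every solution of the unit's signed equations over the realised tuples is
constant; single slots prime ∕ one-member ∕ homogeneous; realised tuples trivial on a unit transitive on every slot outside it). [cite: MoonenZarhin1995Duke, Thm. 2.4]
[cite: Shimura1998, §18.2 Lemma (i)] [cite: DixonMortimer1996, §1.4 Ex. 1.4.1–1.4.2; §1.6 and Thm. 1.6A; §2.1] [cite: Lang2002, XIII §4] -/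
theorem exists_hasDefectsG_realisedTuples_of_unitsSeparated
    (U : Fin r → Fin r) (hn : ∀ m m' : Fin r, U m' = U m → n m' = n m)
    (hdiag : ∀ π ∈ realisedTuples e τ, ∀ (m m' : Fin r) (h : U m' = U m) (a : Fin (n m')), Fin.cast (hn m m' h) (π m' a) = π m (Fin.cast (hn m m' h) a))
    (hstab : ∀ (m₀ m : Fin r), U m₀ ≠ U m → ∀ a a' : Fin (n m), ∃ ν ∈ realisedTuples e τ, (∀ m', U m' = U m₀ → ν m' = 1) ∧ ν m a = a')
    {P : ∀ m : Fin r, Finset (Fin (n m))}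
    (hkind : ∀ m, (∀ m', U m' = U m → m' = m) → ((n m).Prime ∧ (P m).Nonempty ∧ (P m).card < n m) ∨ (P m).card = 1 ∨
      ((0 < (P m).card ∧ (P m).card < n m) ∧ ∀ Q : Finset (Fin (n m)), Q.card = (P m).card → ∃ π ∈ realisedTuples e τ, preG (π m) (P m) = Q))
    (hunit : ∀ m, (∃ m', m' ≠ m ∧ U m' = U m) → ∀ (u : {m' : Fin r // U m' = U m} → Fin (n m) → ℤ) (w : ℤ),
      (∀ π ∈ realisedTuples e τ, (∑ i, ∑ x : Fin (n m), (if π m x ∈ (P i.1).image (Fin.cast (hn m i.1 i.2)) then u i x else -u i x)) = w) →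
      ∀ (i : {m' : Fin r // U m' = U m}) (a b : Fin (n m)), u i a = u i b)
    (c : Fin r → ℕ) (hc : ∀ m, ((c m : ℕ) : ℤ) = (n m : ℤ) - 2 * (P m).card)
    {α : Type} (v : α → PtG n) (T : Finset α) (hT : ModelBalancedG P (realisedTuples e τ) v T) : ∃ t : Fin r → ℤ, HasDefectsG c v T t :=
  exists_hasDefectsG_of_unitsSeparated (fun _ hπ _ hπ' => mul_mem_realisedTuples e τ hπ hπ') (fun _ hπ => inv_mem_realisedTuples hπ)
    (realisedTuples_nonempty (e := e) he_sign) (fun m a b => transitive_realisedTuples (e := e) he_sign m a b) U hn hdiag hstab hkind hunit c hc v T hT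

end Realised

/-! ## §3 The frame headline -/

section Headline

variable {I : Type} {r : ℕ} {Kf : I → Type} [∀ i, Field (Kf i)] [∀ i, NumberField (Kf i)] [∀ i, IsCMField (Kf i)]
  {i₀ : I} {is : Fin r → I} {n : Fin r → ℕ} {τ : Kf i₀ →+* ℂ}
  {A : Fin (r + 1) → AbelianVariety ℂ} {Φ : ∀ j : Fin (r + 1), CMType (Kf (mfSlots i₀ is j))}
  {ι : ∀ j, 𝓞 (Kf (mfSlots i₀ is j)) →+* End (A j)}
  {θ : ∀ j, Kf (mfSlots i₀ is j) →+* Module.End ℂ (complexBetti (A j).X 1)}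

/-- **HEADLINE (frame form) — SEPARATED UNITS WITH THE SLOT MENU ON THE SINGLE SLOTS, GIVEN THE SINGLE-SLOT WEIL SPACES.**  As U2's
`hodgeConjectureFor_biproduct_comp_of_units_frames` with `2`-transitivity + linear independence on the units of two or more slots replaced by the ABSTRACT SEPARATION PROPERTY
`hunit` (every solution of the unit's signed equations over the realised tuples is constant): `k = Kf i₀` imaginary quadratic, `E = A 0 ⊨ (k; {τ})` (`τ(δ) = i√d`),
`B_m = A (m+1) ⊨ (K_m; Φ (m+1))` over CM fields `K_m ⊇ i_m(k)`, `[K_m : k] = n_m`, types read by frames `e m` at position sets `P m` of sizes `p_m` (`0 < p_m`, `2 p_m ≤ n_m`);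
UNITS = the fibres of `U : Fin r → Fin r` (one size, realised tuples diagonal); the realised tuples trivial on a unit transitive on every slot outside it; single slots prime ∕
`p_m = 1` ∕ homogeneous.  Then the Hodge conjecture holds for EVERY product of copies `⨁_j A(κ j)` GIVEN the single-slot Weil spaces `hW m`.  `HC_CM` is NOT asserted.
[cite: Pohlmann1968, Thm 1] [cite: MoonenZarhin1995Duke, Thm. 2.4] [cite: Milne2020HodgeClassesAV, 1.2 (a) and Thm. 1] [cite: DixonMortimer1996, §1.4 Ex. 1.4.1–1.4.2; §1.6
and Thm. 1.6A; §2.1] [cite: Lang2002, XIII §4] -/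
theorem hodgeConjectureFor_biproduct_comp_of_unitsSeparated_frames (P : ∀ m : Fin r, Finset (Fin (n m))) (p : Fin r → ℕ)
    (hcard : ∀ m, (P m).card = p m) (hp0 : ∀ m, 0 < p m) (hpn : ∀ m, 2 * p m ≤ n m)
    {N : ℕ} (κ : Fin N → Fin (r + 1)) (h2 : Module.finrank ℚ (Kf i₀) = 2) (im : ∀ m : Fin r, Kf i₀ →+* Kf (is m))
    {δ : 𝓞 (Kf i₀)} {d : ℕ} (hτ : τ (δ : Kf i₀) = Complex.I * (Real.sqrt d : ℂ))
    (hA : ∀ j, IsCMTypeRealisation (Φ j) (A j) (ι j) (θ j))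
    (e : ∀ m : Fin r, (Kf (is m) →+* ℂ) ≃ Fin (n m) × Bool)
    (he_sign : ∀ (m : Fin r) (s : Kf (is m) →+* ℂ), (e m s).2 = true ↔ s.comp (im m) = τ)
    (he_conj : ∀ (m : Fin r) (s : Kf (is m) →+* ℂ), e m (ComplexEmbedding.conjugate s) = ((e m s).1, !(e m s).2))
    (hΨ : ∀ σ : Kf i₀ →+* ℂ, σ ∈ (Φ 0).1 ↔ σ = τ)
    (hΦ : ∀ (m : Fin r) (s : Kf (is m) →+* ℂ), s ∈ (Φ m.succ).1 ↔ (e m s).2 = decide ((e m s).1 ∈ P m))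
    (U : Fin r → Fin r) (hn : ∀ m m' : Fin r, U m' = U m → n m' = n m)
    (hdiag : ∀ π ∈ realisedTuples e τ, ∀ (m m' : Fin r) (h : U m' = U m) (a : Fin (n m')), Fin.cast (hn m m' h) (π m' a) = π m (Fin.cast (hn m m' h) a))
    (hstab : ∀ (m₀ m : Fin r), U m₀ ≠ U m → ∀ a a' : Fin (n m), ∃ ν ∈ realisedTuples e τ, (∀ m', U m' = U m₀ → ν m' = 1) ∧ ν m a = a')
    (hunit : ∀ m, (∃ m', m' ≠ m ∧ U m' = U m) → ∀ (u : {m' : Fin r // U m' = U m} → Fin (n m) → ℤ) (w : ℤ),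
      (∀ π ∈ realisedTuples e τ, (∑ i, ∑ x : Fin (n m), (if π m x ∈ (P i.1).image (Fin.cast (hn m i.1 i.2)) then u i x else -u i x)) = w) →
      ∀ (i : {m' : Fin r // U m' = U m}) (a b : Fin (n m)), u i a = u i b)
    (hkind : ∀ m : Fin r, (∀ m', U m' = U m → m' = m) → (n m).Prime ∨ p m = 1 ∨
      ∀ Q : Finset (Fin (n m)), Q.card = p m → ∃ π ∈ realisedTuples e τ, preG (π m) (P m) = Q)
    (hW : ∀ m : Fin r, weilClassesOf (⨁ fun i => A (partSlots (n m - 2 * p m) m i))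
      (biproduct.map fun i => ι (partSlots (n m - 2 * p m) m i) (δfam im δ (partSlots (n m - 2 * p m) m i))) (n m - p m) d ≤
      algebraicClasses (⨁ fun i => A (partSlots (n m - 2 * p m) m i)).X (n m - p m)) :
    HodgeConjectureFor (⨁ fun j => A (κ j)).dim (⨁ fun j => A (κ j)).X :=
  hodgeConjectureFor_biproduct_comp_of_defectLawG (is := is) P (fun m => n m - 2 * p m) (fun m => n m - p m)
    (fun m => by have := hpn m; omega) (fun m => by have := hp0 m; have := hpn m; omega) κ h2 im hτ hA e he_sign he_conj hΨ hΦ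
    (fun v T hT => exists_hasDefectsG_realisedTuples_of_unitsSeparated (e := e) he_sign U hn hdiag hstab
      (fun m hsingle => by
        rcases hkind m hsingle with hpr | h1 | hhom
        · exact Or.inl ⟨hpr, Finset.card_pos.1 (by rw [hcard m]; exact hp0 m), by have := hpn m; have := hp0 m; rw [hcard m]; omega⟩
        · exact Or.inr (Or.inl (by rw [hcard m, h1]))
        · exact Or.inr (Or.inr ⟨⟨by rw [hcard m]; exact hp0 m, by have := hpn m; have := hp0 m; rw [hcard m]; omega⟩,
            fun Q hQ => hhom Q (by rw [hQ, hcard m])⟩))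
      hunit (fun m => n m - 2 * p m) (cast_sub_two_mul_eq hcard hpn) v T hT) hW

/-- **Dominated form.** [cite: MumfordAV1970, §19 Thm. 1 and p. 169] [cite: Pohlmann1968, Thm 1] -/
theorem hodgeConjectureFor_of_avDominatedBy_comp_of_unitsSeparated_frames (P : ∀ m : Fin r, Finset (Fin (n m))) (p : Fin r → ℕ)
    (hcard : ∀ m, (P m).card = p m) (hp0 : ∀ m, 0 < p m) (hpn : ∀ m, 2 * p m ≤ n m)
    {N : ℕ} (κ : Fin N → Fin (r + 1)) (h2 : Module.finrank ℚ (Kf i₀) = 2) (im : ∀ m : Fin r, Kf i₀ →+* Kf (is m))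
    {δ : 𝓞 (Kf i₀)} {d : ℕ} (hτ : τ (δ : Kf i₀) = Complex.I * (Real.sqrt d : ℂ))
    (hA : ∀ j, IsCMTypeRealisation (Φ j) (A j) (ι j) (θ j))
    (e : ∀ m : Fin r, (Kf (is m) →+* ℂ) ≃ Fin (n m) × Bool)
    (he_sign : ∀ (m : Fin r) (s : Kf (is m) →+* ℂ), (e m s).2 = true ↔ s.comp (im m) = τ)
    (he_conj : ∀ (m : Fin r) (s : Kf (is m) →+* ℂ), e m (ComplexEmbedding.conjugate s) = ((e m s).1, !(e m s).2))
    (hΨ : ∀ σ : Kf i₀ →+* ℂ, σ ∈ (Φ 0).1 ↔ σ = τ)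
    (hΦ : ∀ (m : Fin r) (s : Kf (is m) →+* ℂ), s ∈ (Φ m.succ).1 ↔ (e m s).2 = decide ((e m s).1 ∈ P m))
    (U : Fin r → Fin r) (hn : ∀ m m' : Fin r, U m' = U m → n m' = n m)
    (hdiag : ∀ π ∈ realisedTuples e τ, ∀ (m m' : Fin r) (h : U m' = U m) (a : Fin (n m')), Fin.cast (hn m m' h) (π m' a) = π m (Fin.cast (hn m m' h) a))
    (hstab : ∀ (m₀ m : Fin r), U m₀ ≠ U m → ∀ a a' : Fin (n m), ∃ ν ∈ realisedTuples e τ, (∀ m', U m' = U m₀ → ν m' = 1) ∧ ν m a = a')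
    (hunit : ∀ m, (∃ m', m' ≠ m ∧ U m' = U m) → ∀ (u : {m' : Fin r // U m' = U m} → Fin (n m) → ℤ) (w : ℤ),
      (∀ π ∈ realisedTuples e τ, (∑ i, ∑ x : Fin (n m), (if π m x ∈ (P i.1).image (Fin.cast (hn m i.1 i.2)) then u i x else -u i x)) = w) →
      ∀ (i : {m' : Fin r // U m' = U m}) (a b : Fin (n m)), u i a = u i b)
    (hkind : ∀ m : Fin r, (∀ m', U m' = U m → m' = m) → (n m).Prime ∨ p m = 1 ∨
      ∀ Q : Finset (Fin (n m)), Q.card = p m → ∃ π ∈ realisedTuples e τ, preG (π m) (P m) = Q)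
    (hW : ∀ m : Fin r, weilClassesOf (⨁ fun i => A (partSlots (n m - 2 * p m) m i))
      (biproduct.map fun i => ι (partSlots (n m - 2 * p m) m i) (δfam im δ (partSlots (n m - 2 * p m) m i))) (n m - p m) d ≤
      algebraicClasses (⨁ fun i => A (partSlots (n m - 2 * p m) m i)).X (n m - p m))
    {X : AbelianVariety ℂ} (hX : Domination.AVDominatedBy X (⨁ fun j => A (κ j))) : HodgeConjectureFor X.dim X.X :=
  Domination.hodgeConjectureFor_of_avDominatedBy
    (hodgeConjectureFor_biproduct_comp_of_unitsSeparated_frames P p hcard hp0 hpn κ h2 im hτ hA e he_sign he_conj hΨ hΦ U hn hdiag hstab hunit hkind hW) hX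

end Headline

end Summit.HodgeConjecture.CorCM.MultiFieldWeil

end
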